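/-
Copyright (c) 2026 the pub-hodgecm-mathlib formalisation cell (harness21).  Prover seat hodgecm-mathlib-LH7-p08 (g0) (re-dealt to strike line L3 `stub_N6nsDyadic` by director
s1969 (a)), Track A «(D-RAM) FOUR-FRAME» squad, helper lane on h413 = stmt-HodgeConjecture-24833 (count-neutral).  β-BOARD v1 row R8 ∕ (P5) «H `(2ρ,2ρ,2ρ)`», FILE 5a: F0P3-p01's
★ HEAD A («the labelled odd count of a ONE-SLOT label») generalised from the slot character `ω(u_k)` to an ARBITRARY character `θ` of `S_F(M₀)` trivial on `N(S̃′(M₀))`.  2026-09-04.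
-/
import Summits.HodgeConjecture.HodgeConjecture.Theorems.F0P3cDyRamLabelledOddOneSlotRead    -- ★ (F0P3-p01 (g36)): §1–§2 (`map_unitNormMap_unitStabilizer_le`, `cl_eq_cl_iff`, `mem_polarisationNormClasses_iff_exists_cl`, `two_mul_ite_eq`, …); brings the ★ DEFS leaf
import Mathlib.RingTheory.IntegralDomain                                                     -- `sum_hom_units` (character sums over a finite group)
import HarnessLib

/-!
# Crux `H413`, line LH4 «(D-RAM) FOUR-FRAME» — (β) table, β-BOARD row R8 ∕ (P5), FILE 5a: «THE LABELLED ODD COUNT OF A CHARACTER LABEL» —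
# `Λ(M₀, D₁·u) = [ε·θ(u) = 1]` for a character `θ : S_F(M₀) → {±1}` trivial on `N(S̃′(M₀))` ⟹ `2·m^Λ_i(M₀) = ω(D_{1,i})·|A|·([ω_i ≡ 1 on S_F] + ε·[ω_i·θ ≡ 1 on S_F])`

Cell `hodgecm-mathlib` (D-0151), FLOOR 0, crux item H413 = `stmt-HodgeConjecture-24833`, route `HCCMUnconditional`; squad F0∕P3c∕LH4.  THEOREMS ONLY (no `def`, no instance, no
notation, no `sorry`, default heartbeats); ★-only imports; lane `--supports stmt-HodgeConjecture-24833 --as helper` (count-neutral); pays NO row, states NO law.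

WHY (this seat's MATH NOTE 21:3xZ on LEDGER #19 (v)∕(iii): the (β) label on the core-hanging stratum is, at EVERY depth of the third root, a CHARACTER label).  On `S_F` of a
core-hanging member the value-class label reads `Λ(D·u) ↔ ω(G)·θ(u) = 1` with `θ(u) = ω(κ·u₁ + (1−κ)·u₂)` (`G = f·g_α + g_β`, `κ = (g_β − g_α)∕G`), and `θ` is multiplicative on
`S_F` (FILE 5b).  In the DEEP and BOUNDARY ranges `θ` collapses to the slot character `ω(u₂)` (★ FILEs 3a∕4a, F0P3-p01's ★ HEAD A at `k = 2`); in the SHALLOW range and on the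
EQUILATERAL locus it does not, and one needs ★ HEAD A for a general character.  THIS FILE is that generalisation — F0P3-p01 (g36)'s ★ `two_mul_labelledOddCount_eq_of_oneSlot` with
`ω(u_k)` replaced by `θ(u)` throughout, same proof (classes `≃ S_F ∕ N′`, ★ `cl_eq_cl_iff`, ★ `mem_polarisationNormClasses_iff_exists_cl`; signed label of a class
`= [ε·θ(u) = 1]·ω(D_{1,i})ω(u_i)`; `[ε·a = 1] = (1 + ε·a)∕2`; character sums `Σ_A ω_i`, `Σ_A ω_i·θ` by Mathlib `sum_hom_units`):
* §1 `classLabelSign_cl_eq_of_character` — the signed label of the class `cl u` under a character label; `character_eq_one_of_label_invariant` — for an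
  `N′`-INVARIANT label (the value-class label of record: ★ `valueClassLabel_mul_norm_iff_of_mem_unitStabilizer`) the character is automatically trivial on `N′`.
* §2 HEAD `two_mul_labelledOddCount_eq_of_character`: `2·m^Λ_i(M₀) = ω(D_{1,i})·|A|·([ω_i ≡ 1 on S_F] + ε·[ω_i·θ ≡ 1 on S_F])`; with a UNIT non-norm the first bracket dies
  (`…_of_unit`); over `ℚ` on a finite orbit (HEAD′): `m^Λ_i(M₀)∕[𝒰 : N′] = ε·ω(D_{1,i})∕2 · [ω_i·θ ≡ 1 on S_F] · stabiliserWeight σ M₀`.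
The character is passed as a bare function `θ : (Fin 3 → Kˣ) → ℤ` with its three properties on `S_F` as hypotheses (multiplicative, `±1`-valued, trivial on `N′`) — no definition.
HONEST LABEL.  Count-neutral (`--supports`); the core-hanging `θ` (FILE 5b), the shallow∕equilateral H rows, `hRest`, (T3), (β-BAL), (β), T₊ stay OPEN; `HC_CM` is proved only modulo
the 7 printed citations (2 remaining named inputs: hLiu418 = `stmt-HodgeConjecture-24832`, h413 = `stmt-HodgeConjecture-24833`) until rung 0 closes.

## References
* [Kottwitz1986BaseChangeUnits] R. E. Kottwitz, *Base change for unit elements of Hecke algebras*, Compositio Math. 60 (1986), §1 pp. 240–241 (signed lattice counts; stabiliser indices).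
* [LanglandsShelstad1987] R. P. Langlands, D. Shelstad, *On the definition of transfer factors*, Math. Ann. 278 (1987), §3 (the characters of `H¹(F, T) = (ℤ∕2)³`).
* [Rogawski1990] J. D. Rogawski, *Automorphic Representations of Unitary Groups in Three Variables*, Ann. of Math. Stud. 123 (1990), §4.9 Prop. 4.9.1 (a)(b) p. 55, §4.10 p. 58.
* [Serre1979] J.-P. Serre, *Local Fields*, GTM 67 (1979), Ch. V §3 Cor. 3; Ch. VI §1 (orthogonality of characters of a finite abelian group).
-/

set_option autoImplicit false

noncomputable section

namespace Summit.HodgeConjecture.HodgeConjecture.Cruxes.H413.F0P3cDyRamLabelledOddCharacterSlotRead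

open Literature.NumberTheory.Automorphic Literature.NumberTheory.Automorphic.HermitianLattice
open Literature.NumberTheory.Automorphic.UnitaryLatticeTree Literature.NumberTheory.Automorphic.UnitaryThreeFourFrame
open Summit.HodgeConjecture.HodgeConjecture.Cruxes.H413.F0P3cDyRamFourFramePieces
open Summit.HodgeConjecture.HodgeConjecture.Cruxes.H413.F0P3cDyRamDiagonalTorusDefs
open Summit.HodgeConjecture.HodgeConjecture.Cruxes.H413.F0P3cDyRamLabelledOddCountDefs
open Summit.HodgeConjecture.HodgeConjecture.Cruxes.H413.F0P3cDyRamDiagonalOrbitFibreTransport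
open Summit.HodgeConjecture.HodgeConjecture.Cruxes.H413.F0P3cDyRamDiagonalOrbitAveraging (relIndex_fixedUnitStabilizer_ne_zero_of_finite)
open Summit.HodgeConjecture.HodgeConjecture.Cruxes.H413.F0P3cDyRamDiagonalLabelledOddOrbitCount (relIndex_map_unitNormMap_unitStabilizer_ne_zero)
open Summit.HodgeConjecture.HodgeConjecture.Cruxes.H413.F0P3cDyRamDiagonalKappaCountEval (normSign_mul_of_dichotomy fixed_of_mem_fixedUnitStabilizer)
open Summit.HodgeConjecture.HodgeConjecture.Cruxes.H413.F0P3cDyRamStableSumSignClasses (normSign_eq_one_or)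
open Summit.HodgeConjecture.HodgeConjecture.Cruxes.H413.F0P3cDyRamLabelledOddOneSlotRead
open scoped Valued WithZero Matrix MatrixGroups

variable {K : Type} [Field K] [Valued K ℤᵐ⁰]

/-! ## §1  The signed label of a class under a character label -/

section Classes

variable {σ : K →+* K} {ϖ : K} {tv : ℕ} {M₀ : Submodule 𝒪[K] (Fin 3 → K)} {D₁ : Fin 3 → K}

/-- **THE SIGNED LABEL OF A CLASS UNDER A CHARACTER LABEL**: if `Λ M₀ (D₁·u) ↔ ε·θ(u) = 1` on `S_F(M₀)` for a function `θ` multiplicative on `S_F` and trivial on `N′ ≤ S_F`, then on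
`cl u` both `Λ M₀` and `ω(·_i)` are constant and `classLabelSign σ i (Λ M₀) (cl u) = if ε·θ(u) = 1 then ω(D_{1,i})·ω(u_i) else 0` (★ `classLabelSign_cl_eq` with `ω(u_k) ↦ θ(u)`).
[cite: Kottwitz1986BaseChangeUnits, §1 pp. 240–241] [cite: LanglandsShelstad1987, §3] -/
theorem classLabelSign_cl_eq_of_character {c : K} (hσc : σ c = c) (hc : ¬ ∃ z : K, z * σ z = c)
    (hdich : ∀ x : K, σ x = x → x ≠ 0 → (∃ z : K, z * σ z = x) ∨ ∃ z : K, z * σ z = c * x)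
    (hD₁ : ∀ j, σ (D₁ j) = D₁ j ∧ D₁ j ≠ 0) (hNS : (unitStabilizer M₀).map (unitNormMap σ 3) ≤ fixedUnitStabilizer σ M₀)
    (Λ : Submodule 𝒪[K] (Fin 3 → K) → (Fin 3 → K) → Prop) (i : Fin 3) (ε : ℤ) (θ : (Fin 3 → Kˣ) → ℤ)
    (hθmul : ∀ u ∈ fixedUnitStabilizer σ M₀, ∀ u' ∈ fixedUnitStabilizer σ M₀, θ (u * u') = θ u * θ u')
    (hθN : ∀ n ∈ (unitStabilizer M₀).map (unitNormMap σ 3), θ n = 1)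
    (hΛ : ∀ u ∈ fixedUnitStabilizer σ M₀, Λ M₀ (fun j => D₁ j * ((u j : Kˣ) : K)) ↔ ε * θ u = 1)
    {u : Fin 3 → Kˣ} (hu : u ∈ fixedUnitStabilizer σ M₀) :
    classLabelSign σ i (Λ M₀) {D' : Fin 3 → K | ∃ n ∈ (unitStabilizer M₀).map (unitNormMap σ 3), ∀ j, D' j = D₁ j * ((u j : Kˣ) : K) * ((n j : Kˣ) : K)} =
      if ε * θ u = 1 then normSign σ (D₁ i) * normSign σ ((u i : Kˣ) : K) else 0 := by
  classical
  set C := {D' : Fin 3 → K | ∃ n ∈ (unitStabilizer M₀).map (unitNormMap σ 3), ∀ j, D' j = D₁ j * ((u j : Kˣ) : K) * ((n j : Kˣ) : K)} with hC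
  have hfixu := fixed_of_mem_fixedUnitStabilizer σ hu
  have hmem : (fun j => D₁ j * ((u j : Kˣ) : K)) ∈ C := ⟨1, one_mem _, fun j => by simp⟩
  -- on `C`, `Λ M₀` is constant `= [ε·θ(u) = 1]` and `ω(·_i)` is constant `= ω(D₁ i)·ω(u_i)`
  have hconst : ∀ D' ∈ C, (Λ M₀ D' ↔ ε * θ u = 1) ∧ normSign σ (D' i) = normSign σ (D₁ i) * normSign σ ((u i : Kˣ) : K) := by
    rintro D' ⟨n, hn, hDn⟩
    have hun : u * n ∈ fixedUnitStabilizer σ M₀ := mul_mem hu (hNS hn)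
    have hD'eq : D' = fun j => D₁ j * (((u * n) j : Kˣ) : K) := funext fun j => by
      rw [hDn j, Pi.mul_apply, Units.val_mul, mul_assoc]
    refine ⟨?_, ?_⟩
    · rw [hD'eq, hΛ _ hun, hθmul u hu n (hNS hn), hθN n hn, mul_one]
    · rw [hDn i, normSign_mul_eq_of_mem_map_unitNormMap σ hn,
        normSign_mul_of_dichotomy σ hσc hc hdich (hD₁ i).1 (hfixu i).1 (hD₁ i).2 (hfixu i).2]
  split_ifs with halive
  · rcases normSign_eq_one_or σ (D₁ i * ((u i : Kˣ) : K)) with h1 | h1 <;>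
      rw [normSign_mul_of_dichotomy σ hσc hc hdich (hD₁ i).1 (hfixu i).1 (hD₁ i).2 (hfixu i).2] at h1 <;> rw [h1]
    · exact classLabelSign_eq_one_of_forall σ i (Λ M₀) fun D' hD' => ⟨(hconst D' hD').1.2 halive, (hconst D' hD').2.trans h1⟩
    · exact classLabelSign_eq_neg_one_of_forall σ i (Λ M₀) ⟨_, hmem⟩ fun D' hD' => ⟨(hconst D' hD').1.2 halive, (hconst D' hD').2.trans h1⟩
  · exact classLabelSign_eq_zero_of_not σ i (Λ M₀) hmem fun hP => halive ((hconst _ hmem).1.1 hP)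

/-- **A CHARACTER LABEL'S CHARACTER IS TRIVIAL ON `N′`** when the label is `N′`-INVARIANT (e.g. the value-class label of record, ★ `valueClassLabel_mul_norm_iff_of_mem_unitStabilizer`):
from `Λ M₀ (D₁·u) ↔ ε·θ(u) = 1` on `S_F ⊇ N′`, `Λ M₀ (D₁·n) ↔ Λ M₀ D₁` for `n ∈ N′`, `θ` multiplicative and `±1`-valued on `S_F`, and `ε = ±1`: `θ(n) = 1` on `N′`.
[cite: Kottwitz1986BaseChangeUnits, §1 pp. 240–241] -/
theorem character_eq_one_of_label_invariant (hNS : (unitStabilizer M₀).map (unitNormMap σ 3) ≤ fixedUnitStabilizer σ M₀)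
    (Λ : Submodule 𝒪[K] (Fin 3 → K) → (Fin 3 → K) → Prop) {ε : ℤ} (hε : ε = 1 ∨ ε = -1) (θ : (Fin 3 → Kˣ) → ℤ)
    (hθmul : ∀ u ∈ fixedUnitStabilizer σ M₀, ∀ u' ∈ fixedUnitStabilizer σ M₀, θ (u * u') = θ u * θ u')
    (hθ1 : ∀ u ∈ fixedUnitStabilizer σ M₀, θ u = 1 ∨ θ u = -1)
    (hΛ : ∀ u ∈ fixedUnitStabilizer σ M₀, Λ M₀ (fun j => D₁ j * ((u j : Kˣ) : K)) ↔ ε * θ u = 1)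
    (hΛN : ∀ n ∈ (unitStabilizer M₀).map (unitNormMap σ 3), Λ M₀ (fun j => D₁ j * ((n j : Kˣ) : K)) ↔ Λ M₀ D₁) :
    ∀ n ∈ (unitStabilizer M₀).map (unitNormMap σ 3), θ n = 1 := by
  intro n hn
  have hθone : θ 1 = 1 := by
    have h := hθmul 1 (one_mem _) 1 (one_mem _)
    rw [one_mul] at h
    rcases hθ1 1 (one_mem _) with h1 | h1
    · exact h1
    · rw [h1] at h; norm_num at h
  have h1 : Λ M₀ D₁ ↔ ε * θ 1 = 1 := by
    have h := hΛ 1 (one_mem _)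
    simp only [Pi.one_apply, Units.val_one, mul_one] at h
    exact h
  have hn' : Λ M₀ D₁ ↔ ε * θ n = 1 := (hΛN n hn).symm.trans (hΛ n (hNS hn))
  rw [hθone, mul_one] at h1
  rcases hθ1 n (hNS hn) with h | h
  · exact h
  · exfalso
    rw [h] at hn'
    rcases hε with rfl | rfl
    · have : (1 : ℤ) * -1 = 1 := (h1.symm.trans hn').1 rfl
      norm_num at this
    · have : (-1 : ℤ) = 1 := (hn'.symm.trans h1).1 (by norm_num)
      norm_num at this

end Classes

/-! ## §2  HEAD — the labelled odd count of a CHARACTER label -/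

section Head

variable {σ : K →+* K} {ϖ : K} {tv : ℕ} {M₀ : Submodule 𝒪[K] (Fin 3 → K)} {D₁ : Fin 3 → K}

open Classical in
/-- **HEAD — THE LABELLED ODD COUNT OF A CHARACTER LABEL.**  Let the type-`tv` polarisations of `M₀` form the coset `D₁·S_F(M₀)` (`hcoset`), `|A| := [S_F(M₀) : N(S̃′(M₀))] ≠ 0`, and let
`Λ M₀ (D₁·u) ↔ ε·θ(u) = 1` on `S_F(M₀)` (`ε = ±1`) for a function `θ : (Fin 3 → Kˣ) → ℤ` which on `S_F(M₀)` is multiplicative, `±1`-valued, and trivial on `N(S̃′(M₀))`.  Then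
`2 · labelledOddCount σ ϖ tv i Λ M₀ = ω(D_{1,i}) · |A| · ([∀ u ∈ S_F, ω(u_i) = 1] + ε · [∀ u ∈ S_F, ω(u_i)·θ(u) = 1])` — ★ HEAD A with `ω(u_k) ↦ θ(u)`.
[cite: Kottwitz1986BaseChangeUnits, §1 pp. 240–241] [cite: LanglandsShelstad1987, §3] [cite: Serre1979, Ch. VI §1] -/
theorem two_mul_labelledOddCount_eq_of_character (hσ : ∀ x, σ (σ x) = x)
    {c : K} (hσc : σ c = c) (hc : ¬ ∃ z : K, z * σ z = c)
    (hdich : ∀ x : K, σ x = x → x ≠ 0 → (∃ z : K, z * σ z = x) ∨ ∃ z : K, z * σ z = c * x)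
    (hD₁ : ∀ j, σ (D₁ j) = D₁ j ∧ D₁ j ≠ 0) (hV₁ : IsVertexLattice σ ϖ (Matrix.diagonal D₁) tv M₀)
    (hcoset : ∀ D : Fin 3 → K, (∀ j, σ (D j) = D j ∧ D j ≠ 0) →
      (IsVertexLattice σ ϖ (Matrix.diagonal D) tv M₀ ↔ ∃ u ∈ fixedUnitStabilizer σ M₀, ∀ j, D j = D₁ j * ((u j : Kˣ) : K)))
    (hA : ((unitStabilizer M₀).map (unitNormMap σ 3)).relIndex (fixedUnitStabilizer σ M₀) ≠ 0)
    (Λ : Submodule 𝒪[K] (Fin 3 → K) → (Fin 3 → K) → Prop) (i : Fin 3) {ε : ℤ} (hε : ε = 1 ∨ ε = -1) (θ : (Fin 3 → Kˣ) → ℤ)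
    (hθmul : ∀ u ∈ fixedUnitStabilizer σ M₀, ∀ u' ∈ fixedUnitStabilizer σ M₀, θ (u * u') = θ u * θ u')
    (hθ1 : ∀ u ∈ fixedUnitStabilizer σ M₀, θ u = 1 ∨ θ u = -1)
    (hθN : ∀ n ∈ (unitStabilizer M₀).map (unitNormMap σ 3), θ n = 1)
    (hΛ : ∀ u ∈ fixedUnitStabilizer σ M₀, Λ M₀ (fun j => D₁ j * ((u j : Kˣ) : K)) ↔ ε * θ u = 1) :
    2 * labelledOddCount σ ϖ tv i Λ M₀ =
      normSign σ (D₁ i) * ((((unitStabilizer M₀).map (unitNormMap σ 3)).relIndex (fixedUnitStabilizer σ M₀) : ℕ) : ℤ) *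
        ((if ∀ u ∈ fixedUnitStabilizer σ M₀, normSign σ ((u i : Kˣ) : K) = 1 then 1 else 0) +
          ε * (if ∀ u ∈ fixedUnitStabilizer σ M₀, normSign σ ((u i : Kˣ) : K) * θ u = 1 then 1 else 0)) := by
  set S := fixedUnitStabilizer σ M₀ with hSdef
  set N' := (unitStabilizer M₀).map (unitNormMap σ 3) with hN'def
  have hNS : N' ≤ S := map_unitNormMap_unitStabilizer_le σ hσ ϖ tv hD₁ hV₁ hcoset
  have hfixS : ∀ u : S, ∀ j, σ ((u.1 j : Kˣ) : K) = u.1 j ∧ ((u.1 j : Kˣ) : K) ≠ 0 := fun u => fixed_of_mem_fixedUnitStabilizer σ u.2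
  -- `θ 1 = 1`
  have hθone : θ 1 = 1 := by
    have h := hθmul 1 (one_mem _) 1 (one_mem _)
    rw [one_mul] at h
    rcases hθ1 1 (one_mem _) with h1 | h1
    · exact h1
    · rw [h1] at h; norm_num at h
  -- the finite quotient `A = S_F ∕ N′`
  set H : Subgroup S := N'.subgroupOf S with hHdef
  have hHi : H.index = N'.relIndex S := rfl
  haveI : H.FiniteIndex := ⟨by rw [hHi]; exact hA⟩
  letI : Fintype (S ⧸ H) := Fintype.ofFinite _
  have hcard : (Fintype.card (S ⧸ H) : ℤ) = ((N'.relIndex S : ℕ) : ℤ) := by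
    rw [← Nat.card_eq_fintype_card, ← Subgroup.index_eq_card, hHi]
  -- the classes, indexed by `A`
  set cl : S → Set (Fin 3 → K) := fun u =>
    {D' : Fin 3 → K | ∃ n ∈ N', ∀ j, D' j = D₁ j * ((u.1 j : Kˣ) : K) * ((n j : Kˣ) : K)} with hcldef
  have hcl : ∀ u u' : S, cl u = cl u' ↔ u⁻¹ * u' ∈ H := fun u u' => by
    rw [Subgroup.mem_subgroupOf, Subgroup.coe_mul, Subgroup.coe_inv]; exact cl_eq_cl_iff hD₁ u.1 u'.1
  let e : S ⧸ H → Set (Fin 3 → K) := Quotient.lift cl fun u u' huu' => (hcl u u').2 (QuotientGroup.leftRel_apply.1 huu')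
  have he_mk : ∀ u : S, e (QuotientGroup.mk u) = cl u := fun u => rfl
  have hbij : Set.BijOn e Set.univ (polarisationNormClasses σ ϖ tv M₀) := by
    refine ⟨fun q _ => ?_, fun q _ q' _ hqq' => ?_, fun C hC => ?_⟩
    · induction q using QuotientGroup.induction_on with
      | H u => rw [he_mk]; exact (mem_polarisationNormClasses_iff_exists_cl hD₁ hcoset _).2 ⟨u.1, u.2, rfl⟩
    · induction q using QuotientGroup.induction_on with
      | H u =>
        induction q' using QuotientGroup.induction_on with
        | H u' => rw [he_mk, he_mk] at hqq'; exact QuotientGroup.eq.2 ((hcl u u').1 hqq')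
    · obtain ⟨u, hu, rfl⟩ := (mem_polarisationNormClasses_iff_exists_cl hD₁ hcoset C).1 hC
      exact ⟨QuotientGroup.mk ⟨u, hu⟩, Set.mem_univ _, rfl⟩
  have hsum : labelledOddCount σ ϖ tv i Λ M₀ = ∑ q : S ⧸ H, classLabelSign σ i (Λ M₀) (e q) := by
    rw [labelledOddCount_eq, ← finsum_mem_eq_of_bijOn (f := fun q => classLabelSign σ i (Λ M₀) (e q)) e hbij (fun _ _ => rfl),
      finsum_mem_univ, finsum_eq_sum_of_fintype]
  -- the slot character `ω_i : S_F →* ℤ`, the character `θ`, and their descents to `A`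
  let χ : S →* ℤ :=
    { toFun := fun u => normSign σ ((u.1 i : Kˣ) : K)
      map_one' := by
        show normSign σ ((((1 : S) : Fin 3 → Kˣ) i : Kˣ) : K) = 1
        rw [OneMemClass.coe_one, Pi.one_apply, Units.val_one]; exact normSign_one_eq σ
      map_mul' := fun u u' => by
        show normSign σ ((((u * u' : S) : Fin 3 → Kˣ) i : Kˣ) : K) = normSign σ ((u.1 i : Kˣ) : K) * normSign σ ((u'.1 i : Kˣ) : K)
        rw [Subgroup.coe_mul, Pi.mul_apply, Units.val_mul]
        exact normSign_mul_of_dichotomy σ hσc hc hdich (hfixS u i).1 (hfixS u' i).1 (hfixS u i).2 (hfixS u' i).2 }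
  let Θ : S →* ℤ :=
    { toFun := fun u => θ u.1
      map_one' := by show θ ((1 : S) : Fin 3 → Kˣ) = 1; rw [OneMemClass.coe_one]; exact hθone
      map_mul' := fun u u' => by
        show θ ((u * u' : S) : Fin 3 → Kˣ) = θ u.1 * θ u'.1
        rw [Subgroup.coe_mul]; exact hθmul u.1 u.2 u'.1 u'.2 }
  have hχ_apply : ∀ u : S, χ u = normSign σ ((u.1 i : Kˣ) : K) := fun _ => rfl
  have hΘ_apply : ∀ u : S, Θ u = θ u.1 := fun _ => rfl
  have hχH : H ≤ χ.ker := fun n hn => by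
    rw [MonoidHom.mem_ker, hχ_apply]
    rw [Subgroup.mem_subgroupOf] at hn
    have h1 := normSign_mul_eq_of_mem_map_unitNormMap σ hn 1 i
    rw [one_mul, normSign_one_eq] at h1
    exact h1
  have hΘH : H ≤ Θ.ker := fun n hn => by
    rw [MonoidHom.mem_ker, hΘ_apply]
    rw [Subgroup.mem_subgroupOf] at hn
    exact hθN n.1 hn
  have hχΘH : H ≤ (χ * Θ).ker := fun n hn => by
    rw [MonoidHom.mem_ker, MonoidHom.mul_apply, show χ n = 1 from hχH hn, show Θ n = 1 from hΘH hn, mul_one]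
  let ψ : S ⧸ H →* ℤ := QuotientGroup.lift H χ hχH
  let ψ2 : S ⧸ H →* ℤ := QuotientGroup.lift H (χ * Θ) hχΘH
  have hψ_mk : ∀ u : S, ψ (QuotientGroup.mk u) = normSign σ ((u.1 i : Kˣ) : K) := fun _ => rfl
  have hψ2_mk : ∀ u : S, ψ2 (QuotientGroup.mk u) = normSign σ ((u.1 i : Kˣ) : K) * θ u.1 := fun _ => rfl
  -- pointwise: `2·classLabelSign (e q) = ω(D₁ i)·(ψ q + ε·ψ2 q)`
  have hpt : ∀ q : S ⧸ H, 2 * classLabelSign σ i (Λ M₀) (e q) = normSign σ (D₁ i) * (ψ q + ε * ψ2 q) := by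
    intro q
    induction q using QuotientGroup.induction_on with
    | H u =>
      rw [he_mk, hψ_mk, hψ2_mk]
      rw [show cl u = {D' : Fin 3 → K | ∃ n ∈ (unitStabilizer M₀).map (unitNormMap σ 3), ∀ j, D' j = D₁ j * ((u.1 j : Kˣ) : K) * ((n j : Kˣ) : K)}
        from rfl, classLabelSign_cl_eq_of_character hσc hc hdich hD₁ hNS Λ i ε θ hθmul hθN hΛ u.2]
      exact two_mul_ite_eq hε (hθ1 u.1 u.2) _ _
  -- the two character sums
  have hS1 : (∑ q : S ⧸ H, ψ q) = if (∀ u ∈ fixedUnitStabilizer σ M₀, normSign σ ((u i : Kˣ) : K) = 1) then ((N'.relIndex S : ℕ) : ℤ) else 0 := by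
    have hiff : ψ = 1 ↔ ∀ u ∈ fixedUnitStabilizer σ M₀, normSign σ ((u i : Kˣ) : K) = 1 := by
      refine ⟨fun h u hu => ?_, fun h => ?_⟩
      · have := DFunLike.congr_fun h (QuotientGroup.mk ⟨u, hu⟩)
        rwa [hψ_mk, MonoidHom.one_apply] at this
      · refine MonoidHom.ext fun q => ?_
        induction q using QuotientGroup.induction_on with
        | H u => rw [hψ_mk, MonoidHom.one_apply]; exact h u.1 u.2
    rw [sum_hom_units ψ, Nat.cast_ite, Nat.cast_zero]
    exact if_congr hiff hcard rfl
  have hS2 : (∑ q : S ⧸ H, ψ2 q) =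
      if (∀ u ∈ fixedUnitStabilizer σ M₀, normSign σ ((u i : Kˣ) : K) * θ u = 1) then ((N'.relIndex S : ℕ) : ℤ) else 0 := by
    have hiff : ψ2 = 1 ↔ ∀ u ∈ fixedUnitStabilizer σ M₀, normSign σ ((u i : Kˣ) : K) * θ u = 1 := by
      refine ⟨fun h u hu => ?_, fun h => ?_⟩
      · have := DFunLike.congr_fun h (QuotientGroup.mk ⟨u, hu⟩)
        rwa [hψ2_mk, MonoidHom.one_apply] at this
      · refine MonoidHom.ext fun q => ?_
        induction q using QuotientGroup.induction_on with
        | H u => rw [hψ2_mk, MonoidHom.one_apply]; exact h u.1 u.2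
    rw [sum_hom_units ψ2, Nat.cast_ite, Nat.cast_zero]
    exact if_congr hiff hcard rfl
  -- assemble
  rw [hsum, Finset.mul_sum, Finset.sum_congr rfl fun q _ => hpt q, ← Finset.mul_sum, Finset.sum_add_distrib, ← Finset.mul_sum, hS1, hS2]
  split_ifs <;> ring

open Classical in
/-- **HEAD, UNIT NON-NORM FORM** (the scalar stabiliser `(c, c, c) ∈ S_F(M₀)` kills `[ω_i ≡ 1 on S_F]`, ★ `not_forall_normSign_apply_eq_one`):
`2 · labelledOddCount σ ϖ tv i Λ M₀ = ε · ω(D_{1,i}) · |A| · [∀ u ∈ S_F, ω(u_i)·θ(u) = 1]`. [cite: Kottwitz1986BaseChangeUnits, §1 pp. 240–241] [cite: LanglandsShelstad1987, §3] -/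
theorem two_mul_labelledOddCount_eq_of_character_of_unit (hσ : ∀ x, σ (σ x) = x)
    {c : K} (hσc : σ c = c) (hcv : Valued.v c = 1) (hc : ¬ ∃ z : K, z * σ z = c)
    (hdich : ∀ x : K, σ x = x → x ≠ 0 → (∃ z : K, z * σ z = x) ∨ ∃ z : K, z * σ z = c * x)
    (hD₁ : ∀ j, σ (D₁ j) = D₁ j ∧ D₁ j ≠ 0) (hV₁ : IsVertexLattice σ ϖ (Matrix.diagonal D₁) tv M₀)
    (hcoset : ∀ D : Fin 3 → K, (∀ j, σ (D j) = D j ∧ D j ≠ 0) →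
      (IsVertexLattice σ ϖ (Matrix.diagonal D) tv M₀ ↔ ∃ u ∈ fixedUnitStabilizer σ M₀, ∀ j, D j = D₁ j * ((u j : Kˣ) : K)))
    (hA : ((unitStabilizer M₀).map (unitNormMap σ 3)).relIndex (fixedUnitStabilizer σ M₀) ≠ 0)
    (Λ : Submodule 𝒪[K] (Fin 3 → K) → (Fin 3 → K) → Prop) (i : Fin 3) {ε : ℤ} (hε : ε = 1 ∨ ε = -1) (θ : (Fin 3 → Kˣ) → ℤ)
    (hθmul : ∀ u ∈ fixedUnitStabilizer σ M₀, ∀ u' ∈ fixedUnitStabilizer σ M₀, θ (u * u') = θ u * θ u')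
    (hθ1 : ∀ u ∈ fixedUnitStabilizer σ M₀, θ u = 1 ∨ θ u = -1)
    (hθN : ∀ n ∈ (unitStabilizer M₀).map (unitNormMap σ 3), θ n = 1)
    (hΛ : ∀ u ∈ fixedUnitStabilizer σ M₀, Λ M₀ (fun j => D₁ j * ((u j : Kˣ) : K)) ↔ ε * θ u = 1) :
    2 * labelledOddCount σ ϖ tv i Λ M₀ =
      ε * normSign σ (D₁ i) * ((((unitStabilizer M₀).map (unitNormMap σ 3)).relIndex (fixedUnitStabilizer σ M₀) : ℕ) : ℤ) *
        (if ∀ u ∈ fixedUnitStabilizer σ M₀, normSign σ ((u i : Kˣ) : K) * θ u = 1 then 1 else 0) := by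
  rw [two_mul_labelledOddCount_eq_of_character hσ hσc hc hdich hD₁ hV₁ hcoset hA Λ i hε θ hθmul hθ1 hθN hΛ,
    if_neg (not_forall_normSign_apply_eq_one σ M₀ hσc hcv hc i)]
  ring

open Classical in
/-- **HEAD′ — THE PER-ORBIT TERM UNDER A CHARACTER LABEL** (over `ℚ`, on a finite unit-torus orbit; `[𝒰 : N(S̃′)] = |A|·[𝒰 : S_F]` by the tower):
`labelledOddCount σ ϖ tv i Λ M₀ ∕ [𝒰 : N(S̃′(M₀))] = ε·ω(D_{1,i})∕2 · [∀ u ∈ S_F, ω(u_i)·θ(u) = 1] · stabiliserWeight σ M₀` (★ HEAD A′ with `ω(u_k) ↦ θ(u)`).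
[cite: Kottwitz1986BaseChangeUnits, §1 pp. 240–241] [cite: LanglandsShelstad1987, §3] [cite: Rogawski1990, §4.9 Prop. 4.9.1 (a)(b) p. 55] -/
theorem labelledOddCount_div_relIndex_eq_of_character (hσ : ∀ x, σ (σ x) = x) (hvσ : ∀ a, Valued.v (σ a) = Valued.v a)
    {c : K} (hσc : σ c = c) (hcv : Valued.v c = 1) (hc : ¬ ∃ z : K, z * σ z = c)
    (hdich : ∀ x : K, σ x = x → x ≠ 0 → (∃ z : K, z * σ z = x) ∨ ∃ z : K, z * σ z = c * x)
    (hfin : {M : Submodule 𝒪[K] (Fin 3 → K) | ∃ u ∈ unitTorus K 3, M = mapGL (diagGLUnits u) M₀}.Finite)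
    (hD₁ : ∀ j, σ (D₁ j) = D₁ j ∧ D₁ j ≠ 0) (hV₁ : IsVertexLattice σ ϖ (Matrix.diagonal D₁) tv M₀)
    (hcoset : ∀ D : Fin 3 → K, (∀ j, σ (D j) = D j ∧ D j ≠ 0) →
      (IsVertexLattice σ ϖ (Matrix.diagonal D) tv M₀ ↔ ∃ u ∈ fixedUnitStabilizer σ M₀, ∀ j, D j = D₁ j * ((u j : Kˣ) : K)))
    (Λ : Submodule 𝒪[K] (Fin 3 → K) → (Fin 3 → K) → Prop) (i : Fin 3) {ε : ℤ} (hε : ε = 1 ∨ ε = -1) (θ : (Fin 3 → Kˣ) → ℤ)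
    (hθmul : ∀ u ∈ fixedUnitStabilizer σ M₀, ∀ u' ∈ fixedUnitStabilizer σ M₀, θ (u * u') = θ u * θ u')
    (hθ1 : ∀ u ∈ fixedUnitStabilizer σ M₀, θ u = 1 ∨ θ u = -1)
    (hθN : ∀ n ∈ (unitStabilizer M₀).map (unitNormMap σ 3), θ n = 1)
    (hΛ : ∀ u ∈ fixedUnitStabilizer σ M₀, Λ M₀ (fun j => D₁ j * ((u j : Kˣ) : K)) ↔ ε * θ u = 1) :
    (labelledOddCount σ ϖ tv i Λ M₀ : ℚ) / ((((unitStabilizer M₀).map (unitNormMap σ 3)).relIndex (fixedUnitTorus σ 3) : ℕ) : ℚ) =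
      (ε : ℚ) * (normSign σ (D₁ i) : ℚ) / 2 *
        ((if ∀ u ∈ fixedUnitStabilizer σ M₀, normSign σ ((u i : Kˣ) : K) * θ u = 1 then 1 else 0 : ℤ) : ℚ) *
        stabiliserWeight σ M₀ := by
  classical
  set S := fixedUnitStabilizer σ M₀ with hSdef
  set N' := (unitStabilizer M₀).map (unitNormMap σ 3) with hN'def
  have hNS : N' ≤ S := map_unitNormMap_unitStabilizer_le σ hσ ϖ tv hD₁ hV₁ hcoset
  have hSU : S ≤ fixedUnitTorus σ 3 := inf_le_right
  have hUN : N'.relIndex (fixedUnitTorus σ 3) ≠ 0 := relIndex_map_unitNormMap_unitStabilizer_ne_zero hσ hvσ hσc hcv hc hdich hfin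
  have htower : N'.relIndex S * S.relIndex (fixedUnitTorus σ 3) = N'.relIndex (fixedUnitTorus σ 3) := Subgroup.relIndex_mul_relIndex N' S _ hNS hSU
  have hA : N'.relIndex S ≠ 0 := fun h => hUN (by rw [← htower, h, zero_mul])
  have hSF : S.relIndex (fixedUnitTorus σ 3) ≠ 0 := relIndex_fixedUnitStabilizer_ne_zero_of_finite σ hfin
  have h2 := two_mul_labelledOddCount_eq_of_character_of_unit hσ hσc hcv hc hdich hD₁ hV₁ hcoset hA Λ i hε θ hθmul hθ1 hθN hΛ
  have h2Q : (2 : ℚ) * (labelledOddCount σ ϖ tv i Λ M₀ : ℚ) = (ε : ℚ) * (normSign σ (D₁ i) : ℚ) * ((N'.relIndex S : ℕ) : ℚ) *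
      ((if ∀ u ∈ fixedUnitStabilizer σ M₀, normSign σ ((u i : Kˣ) : K) * θ u = 1 then 1 else 0 : ℤ) : ℚ) := by
    exact_mod_cast h2
  have hA' : ((N'.relIndex S : ℕ) : ℚ) ≠ 0 := Nat.cast_ne_zero.2 hA
  have hSF' : ((S.relIndex (fixedUnitTorus σ 3) : ℕ) : ℚ) ≠ 0 := Nat.cast_ne_zero.2 hSF
  have hL : (labelledOddCount σ ϖ tv i Λ M₀ : ℚ) = (ε : ℚ) * (normSign σ (D₁ i) : ℚ) * ((N'.relIndex S : ℕ) : ℚ) *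
      ((if ∀ u ∈ fixedUnitStabilizer σ M₀, normSign σ ((u i : Kˣ) : K) * θ u = 1 then 1 else 0 : ℤ) : ℚ) / 2 := by
    linarith
  rw [hL, stabiliserWeight, ← hSdef, ← htower, Nat.cast_mul]
  field_simp

end Head

end Summit.HodgeConjecture.HodgeConjecture.Cruxes.H413.F0P3cDyRamLabelledOddCharacterSlotRead

end
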